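import Summits.BirchSwinnertonDyer.BirchSwinnertonDyer.Theorems.TeichmullerTwistDescentDefs
import Summits.BirchSwinnertonDyer.BirchSwinnertonDyer.Theorems.TeichmullerTwistDescentTypeLatticeNoCaseOne
import Summits.BirchSwinnertonDyer.BirchSwinnertonDyer.Theorems.TeichmullerTwistDescentTwistedPeriodLatticeSaturationOfNoCaseOne
import HarnessLib

/-!
# Route `TeichmullerTwistDescent`, crux K `TwistedPeriodLatticeSaturation` (stmt-BirchSwinnertonDyer-25368):
# K ⟸ Modularity ∧ (a tame-type lattice datum at every instance) — the F″-free K-line as ONE implication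

Cell `pub/bsd-wall` (D-0145 line route-BirchSwinnertonDyer-TeichmullerTwistDescent, OPEN rev 7), seat `bsd-line-ttd-p1`
(prover 1/2, g22).  THEOREMS ONLY (no definition, no named fact, no `sorry`).  BSD is not proved by this file; K is NOT
proved: it is reduced, granted the Modularity theorem `exists_isNewformOf` (as in the registered `stub_dichotomy`), to
the existence at every instance `(W, p, D, χ)` of a `TameTypeLatticeDatum` (`TeichmullerTwistDescentDefs`) for
`(Λ(f_D), Λ(f_D ⊗ χ), g(χ))` — the typed content of the carriers (I1) automorphic type + (I2) transfer + (I3)–(I4)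
weights in cohomology + (I6) Kodaira exponent of the audited mechanism (ttd-p1 g19 `AUDIT-K-MECHANISM`, g22
`KLINE-COMPOSED`; evidence on 25368), none of which is in the tree.

* `not_caseOne_of_datum` — a datum excludes «case one» (`TypeLatticeNoCaseOne.not_caseOne_of_typeLatticeDatum` on the
  fields);
* `noCaseOne_of_data` — the registered signature of `stub_noCaseOne` VERBATIM from a datum at every instance;
* **`twistedPeriodLatticeSaturation_of_modularity_of_data`** — `exists_isNewformOf →
  (∀ instances, ∃ k, Nonempty (TameTypeLatticeDatum p k Λ(f_D) Λ(f_D⊗χ) g(χ))) → TwistedPeriodLatticeSaturation`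
  (the route decl BY NAME), via the tree's `twistedPeriodLatticeSaturation_of_modularity_of_noCaseOne`;
* `saturation_at_of_datum` (p ≥ 11) / `saturation_at_of_datum_of_five_le` (p ≥ 5, incl. the Kummer corners) — pointwise forms;
* `exists_zmod_residueAlgebra` — `k := ZMod p` with `toZMod` discharges `hsurj`, `halg`;
* `ordinaryLowValuationGeEleven_of_facts_of_data` — hence GE11 (stmt-23885) from the displayed cite bundle
  `EdixhovenKodairaAndModularityFacts` (stmt-25370) and the data (tree `ordinaryLowValuationGeEleven_of_facts_of_noCaseOne`).
-/

set_option autoImplicit false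
-- single-conjunct summit: `Summit.BirchSwinnertonDyer.BirchSwinnertonDyer.…` repeats the name by design
set_option linter.dupNamespace false

noncomputable section

open Function WeierstrassCurve
open Literature.NumberTheory.EllipticCurves Literature.NumberTheory.EllipticCurves.ModularForms
  Summit.BirchSwinnertonDyer.BirchSwinnertonDyer.Theses.TeichmullerTwistDescent

namespace Summit.BirchSwinnertonDyer.BirchSwinnertonDyer.Theorems.TeichmullerTwistDescent.TypeLatticeDatumK

/-- **A tame-type lattice datum excludes «case one».**  For `p` odd, additive subgroups `Λf, Λfχ ⊆ ℂ`, `g ∈ ℂ` and a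
datum `d : TameTypeLatticeDatum p k Λf Λfχ g`: `¬ (∀ w ∈ Λfχ, ∃ z ∈ Λf, g·w = p·z)`.
[cite: EmertonGeeSavitt2015, Lemma 4.1.1] [cite: Lang1990, Ch. 1 §2 Thm. 2.1] -/
theorem not_caseOne_of_datum (p : ℕ) [Fact p.Prime] (hp2 : p ≠ 2) {k : Type} [Field k] [CharP k p]
    [Algebra ℤ_[p] k] [Finite k] {Λf Λfχ : AddSubgroup ℂ} {g : ℂ} (d : TameTypeLatticeDatum p k Λf Λfχ g) :
    ¬ (∀ w ∈ Λfχ, ∃ z ∈ Λf, g * w = (p : ℂ) * z) :=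
  TypeLatticeNoCaseOne.not_caseOne_of_typeLatticeDatum p hp2 d.hb d.hb2 d.hsurj d.halg d.Λ' d.hm d.hsoc g
    d.hframe d.βW d.βV d.hβW d.hβV d.hβ

/-- **`stub_noCaseOne` (registered signature, verbatim) from a datum at every instance.**  If at every instance
`(W, p, D, χ)` of the crux binders there is a residue field `k` and a `TameTypeLatticeDatum p k Λ(f_D) Λ(f_D⊗χ) g(χ)`,
then the index-`p²` member `g(χ)Λ(f_D⊗χ) ⊆ pΛ(f_D)` never occurs. [cite: EdixhovenManin1991, §4] -/
theorem noCaseOne_of_data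
    (hdat : ∀ (W : WeierstrassCurve ℚ) [W.IsElliptic] [W.IsGloballyMinimal] (p : ℕ) [Fact p.Prime]
      [NeZero (W.conductorNorm ℤ)] (D : ModularParametrizationData W (W.conductorNorm ℤ))
      (hsq : p ^ 2 ∣ W.conductorNorm ℤ), 11 ≤ p → Rank1Residual.Addv W p → Rank1Residual.Irr W p →
      Summit.BirchSwinnertonDyer.Rank1Residual.Additive.TypeGOrd W p →
      padicValInt p W.minimalDiscriminantInt ≤ 4 →
      (∀ z ∈ D.L.lattice, ∃ w ∈ periodLattice D.f, z = D.c * w) →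
      ∀ (χ : DirichletCharacter ℂ p) (hχ : χ.IsQuadratic), χ.IsPrimitive →
        ∃ (k : Type) (_ : Field k) (_ : CharP k p) (_ : Algebra ℤ_[p] k) (_ : Finite k),
          Nonempty (TameTypeLatticeDatum p k (periodLattice D.f)
            (periodLattice (charTwist (W.conductorNorm ℤ) (dvd_refl _) hsq hχ D.f))
            (gaussSum χ (ZMod.stdAddChar (N := p))))) :
    ∀ (W : WeierstrassCurve ℚ) [W.IsElliptic] [W.IsGloballyMinimal] (p : ℕ) [Fact p.Prime]
      [NeZero (W.conductorNorm ℤ)] (D : ModularParametrizationData W (W.conductorNorm ℤ))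
      (hsq : p ^ 2 ∣ W.conductorNorm ℤ), 11 ≤ p → Rank1Residual.Addv W p → Rank1Residual.Irr W p →
      Summit.BirchSwinnertonDyer.Rank1Residual.Additive.TypeGOrd W p →
      padicValInt p W.minimalDiscriminantInt ≤ 4 →
      (∀ z ∈ D.L.lattice, ∃ w ∈ periodLattice D.f, z = D.c * w) →
      ∀ (χ : DirichletCharacter ℂ p) (hχ : χ.IsQuadratic), χ.IsPrimitive →
        ¬ (∀ w ∈ periodLattice (charTwist (W.conductorNorm ℤ) (dvd_refl _) hsq hχ D.f),
            ∃ z ∈ periodLattice D.f, gaussSum χ (ZMod.stdAddChar (N := p)) * w = (p : ℂ) * z) := by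
  intro W _ _ p _ _ D hsq hp11 hadd hirr hGo hV4 hopt χ hχ hprim
  obtain ⟨k, hk₁, hk₂, hk₃, hk₄, ⟨d⟩⟩ := hdat W p D hsq hp11 hadd hirr hGo hV4 hopt χ hχ hprim
  exact not_caseOne_of_datum p (by omega) d

/-- **K ⟸ Modularity ∧ data.**  `TwistedPeriodLatticeSaturation` (the route decl of crux K, stmt-BirchSwinnertonDyer-25368)
follows from the Modularity theorem `exists_isNewformOf` and a tame-type lattice datum at every instance of its binders
— the F″-free K-line (audit (S1)–(S10)) with (S7), (S8), (I5) and Stickelberger discharged in the tree and the carriers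
(I1)–(I4), (I6) packaged as the datum. [cite: EdixhovenManin1991, §4] [cite: EmertonGeeSavitt2015, Lemma 4.1.1] -/
theorem twistedPeriodLatticeSaturation_of_modularity_of_data (hnf : exists_isNewformOf)
    (hdat : ∀ (W : WeierstrassCurve ℚ) [W.IsElliptic] [W.IsGloballyMinimal] (p : ℕ) [Fact p.Prime]
      [NeZero (W.conductorNorm ℤ)] (D : ModularParametrizationData W (W.conductorNorm ℤ))
      (hsq : p ^ 2 ∣ W.conductorNorm ℤ), 11 ≤ p → Rank1Residual.Addv W p → Rank1Residual.Irr W p →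
      Summit.BirchSwinnertonDyer.Rank1Residual.Additive.TypeGOrd W p →
      padicValInt p W.minimalDiscriminantInt ≤ 4 →
      (∀ z ∈ D.L.lattice, ∃ w ∈ periodLattice D.f, z = D.c * w) →
      ∀ (χ : DirichletCharacter ℂ p) (hχ : χ.IsQuadratic), χ.IsPrimitive →
        ∃ (k : Type) (_ : Field k) (_ : CharP k p) (_ : Algebra ℤ_[p] k) (_ : Finite k),
          Nonempty (TameTypeLatticeDatum p k (periodLattice D.f)
            (periodLattice (charTwist (W.conductorNorm ℤ) (dvd_refl _) hsq hχ D.f))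
            (gaussSum χ (ZMod.stdAddChar (N := p))))) :
    TwistedPeriodLatticeSaturation :=
  twistedPeriodLatticeSaturation_of_modularity_of_noCaseOne hnf (noCaseOne_of_data hdat)

/-- **GE11 ⟸ the displayed cite bundle `EdixhovenKodairaAndModularityFacts` (stmt-25370) ∧ data** — Edixhoven's open
case (`p ≥ 11`, potentially good ordinary, Kodaira II/III/IV, `E[p]` irreducible: `p ∤ c₀`) from the data, through
the landed LINE-11 glue (25371) and NTL (25369). [cite: EdixhovenManin1991, Thm. 3 and §4] -/
theorem ordinaryLowValuationGeEleven_of_facts_of_data (hF : EdixhovenKodairaAndModularityFacts)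
    (hdat : ∀ (W : WeierstrassCurve ℚ) [W.IsElliptic] [W.IsGloballyMinimal] (p : ℕ) [Fact p.Prime]
      [NeZero (W.conductorNorm ℤ)] (D : ModularParametrizationData W (W.conductorNorm ℤ))
      (hsq : p ^ 2 ∣ W.conductorNorm ℤ), 11 ≤ p → Rank1Residual.Addv W p → Rank1Residual.Irr W p →
      Summit.BirchSwinnertonDyer.Rank1Residual.Additive.TypeGOrd W p →
      padicValInt p W.minimalDiscriminantInt ≤ 4 →
      (∀ z ∈ D.L.lattice, ∃ w ∈ periodLattice D.f, z = D.c * w) →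
      ∀ (χ : DirichletCharacter ℂ p) (hχ : χ.IsQuadratic), χ.IsPrimitive →
        ∃ (k : Type) (_ : Field k) (_ : CharP k p) (_ : Algebra ℤ_[p] k) (_ : Finite k),
          Nonempty (TameTypeLatticeDatum p k (periodLattice D.f)
            (periodLattice (charTwist (W.conductorNorm ℤ) (dvd_refl _) hsq hχ D.f))
            (gaussSum χ (ZMod.stdAddChar (N := p))))) :
    OrdinaryLowValuationOptimalManinUnitGeEleven :=
  ordinaryLowValuationGeEleven_of_facts_of_noCaseOne hF (noCaseOne_of_data hdat)

/-- **Saturation `Λ(f_D) ⊆ g(χ)·Λ(f_D ⊗ χ)` at EVERY `p ≥ 5` from Modularity and a datum** (potentially good: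
`0 ≤ ord_p j`; `ord_pΔ_min < 6`, i.e. Kodaira II/III/IV including the Kummer corners `(5, III)`, `(7, II)`; `E[p]`
irreducible; `D` lattice-optimal at conductor level; `χ` primitive quadratic): the `p ≥ 5` index dichotomy
`index_dichotomy_of_modularity` leaves saturation or «case one», and the datum excludes case one.  At `p ∈ {5, 7}` this
is the lattice half of the audit's «TIE» `ord_p c(W) = ord_p c(V)` across a Kodaira pair (g19 AUDIT §5); it gives no
`p ∤ c` there by itself. [cite: EdixhovenManin1991, §4] [cite: EmertonGeeSavitt2015, Lemma 4.1.1] -/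
theorem saturation_at_of_datum_of_five_le (hnf : exists_isNewformOf) (W : WeierstrassCurve ℚ) [W.IsElliptic]
    [W.IsGloballyMinimal] (p : ℕ) [Fact p.Prime] [NeZero (W.conductorNorm ℤ)]
    (D : ModularParametrizationData W (W.conductorNorm ℤ)) (hsq : p ^ 2 ∣ W.conductorNorm ℤ) (hp5 : 5 ≤ p)
    (hadd : Rank1Residual.Addv W p) (hirr : Rank1Residual.Irr W p) (hj : 0 ≤ padicValRat p W.j)
    (hW6 : padicValInt p W.minimalDiscriminantInt < 6)
    (hopt : ∀ z ∈ D.L.lattice, ∃ w ∈ periodLattice D.f, z = D.c * w)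
    (χ : DirichletCharacter ℂ p) (hχ : χ.IsQuadratic) (hprim : χ.IsPrimitive)
    {k : Type} [Field k] [CharP k p] [Algebra ℤ_[p] k] [Finite k]
    (d : TameTypeLatticeDatum p k (periodLattice D.f)
      (periodLattice (charTwist (W.conductorNorm ℤ) (dvd_refl _) hsq hχ D.f)) (gaussSum χ (ZMod.stdAddChar (N := p)))) :
    ∀ z ∈ periodLattice D.f, ∃ w ∈ periodLattice (charTwist (W.conductorNorm ℤ) (dvd_refl _) hsq hχ D.f),
      z = gaussSum χ (ZMod.stdAddChar (N := p)) * w := by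
  rcases TwistedPeriodLatticeDichotomy.index_dichotomy_of_modularity hnf W p D hsq hp5 hadd hirr hj hW6 hopt χ hχ
      hprim with h | hcase
  · exact h
  · exact (not_caseOne_of_datum p (by omega) d hcase).elim

/-- **The conclusion of K at `(W, p, D, χ)` from Modularity and a datum at that instance** (`p ≥ 11`, binders of
`TwistedPeriodLatticeSaturation` verbatim). [cite: EdixhovenManin1991, §4] [cite: EmertonGeeSavitt2015, Lemma 4.1.1] -/
theorem saturation_at_of_datum (hnf : exists_isNewformOf) (W : WeierstrassCurve ℚ) [W.IsElliptic]
    [W.IsGloballyMinimal] (p : ℕ) [Fact p.Prime] [NeZero (W.conductorNorm ℤ)]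
    (D : ModularParametrizationData W (W.conductorNorm ℤ)) (hsq : p ^ 2 ∣ W.conductorNorm ℤ) (hp11 : 11 ≤ p)
    (hadd : Rank1Residual.Addv W p) (hirr : Rank1Residual.Irr W p)
    (hGo : Summit.BirchSwinnertonDyer.Rank1Residual.Additive.TypeGOrd W p)
    (hV4 : padicValInt p W.minimalDiscriminantInt ≤ 4)
    (hopt : ∀ z ∈ D.L.lattice, ∃ w ∈ periodLattice D.f, z = D.c * w)
    (χ : DirichletCharacter ℂ p) (hχ : χ.IsQuadratic) (hprim : χ.IsPrimitive)
    {k : Type} [Field k] [CharP k p] [Algebra ℤ_[p] k] [Finite k]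
    (d : TameTypeLatticeDatum p k (periodLattice D.f)
      (periodLattice (charTwist (W.conductorNorm ℤ) (dvd_refl _) hsq hχ D.f)) (gaussSum χ (ZMod.stdAddChar (N := p)))) :
    ∀ z ∈ periodLattice D.f, ∃ w ∈ periodLattice (charTwist (W.conductorNorm ℤ) (dvd_refl _) hsq hχ D.f),
      z = gaussSum χ (ZMod.stdAddChar (N := p)) * w := by
  rcases TwistedPeriodLatticeDichotomy.stub_dichotomy_of_modularity hnf W p D hsq hp11 hadd hirr hGo hV4 hopt χ hχ
      hprim with h | hcase
  · exact h
  · exact (not_caseOne_of_datum p (by omega) d hcase).elim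

/-- **The residue field `k = ℤ/p` discharges the fields `hsurj`, `halg` of the datum**: with the algebra structure
`ℤ_p → ℤ/p` given by `PadicInt.toZMod` (Mathlib has no global instance; take `letI := alg`), the structure map is onto and
factors through `toZMod` tautologically (`ZMod.castHom (dvd_refl p) (ZMod p) = id`).  So a consumer may always take
`k := ZMod p`. [cite: EmertonGeeSavitt2015, Lemma 4.1.1] -/
theorem exists_zmod_residueAlgebra (p : ℕ) [Fact p.Prime] :
    ∃ alg : Algebra ℤ_[p] (ZMod p),
      Function.Surjective (@algebraMap ℤ_[p] (ZMod p) _ _ alg) ∧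
        ∀ x : ℤ_[p], @algebraMap ℤ_[p] (ZMod p) _ _ alg x = ZMod.castHom (dvd_refl p) (ZMod p) (PadicInt.toZMod x) := by
  refine ⟨(PadicInt.toZMod (p := p)).toAlgebra, ?_, fun x => ?_⟩
  · exact ZMod.ringHom_surjective _
  · rw [ZMod.castHom_self, RingHom.id_apply]
    rfl

end Summit.BirchSwinnertonDyer.BirchSwinnertonDyer.Theorems.TeichmullerTwistDescent.TypeLatticeDatumK
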